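import Literature.NumberTheory.Automorphic.UnitaryGroupDirectSumCarriersFinite
import Literature.NumberTheory.Automorphic.UnitaryGroupLevelTransport
import Literature.NumberTheory.Automorphic.Liu2021.AppendixC.PropC5
import HarnessLib

/-!
# Levels along the frame embedding `U(J₁) ↪ U(H)`, `γ ↦ B·(γ ⊕ 1)·B⁻¹`: restricted levels, rational points, arithmetic levels,
# torsion-freeness transfer

Topic `NumberTheory/Automorphic`; namespaces `Literature.NumberTheory.Automorphic.Liu2021.AppendixC.C5.OpenCompactSubgroup` (§1)
and `Literature.NumberTheory.Automorphic.UnitaryGroup` (§§2–4).  Two non-Prop definitions (`OpenCompactSubgroup.restrict`,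
`UnitaryGroup.embRational`) and theorems; NO named fact, NO instance, NO `sorry`; net Literature debt 0.  Generic ranks `N₁ N₂`,
any CM extension `E/F` with involution `c`.

SETTING.  For Gram matrices `J₁ ∈ M_{N₁}(E)`, `J₂ ∈ M_{N₂}(E)`, `H ∈ M_{N₁+N₂}(E)` and a rational similitude frame `B ∈ GL_{N₁+N₂}(E)`,
`a ∈ E^×` with `ᵗ(cB)·(a·H)·B = J₁ ⊕ᶠ J₂` (`formCongr c B (a • H) = finSum N₁ N₂ J₁ J₂`), the finite-adelic embedding
`φ = R_B ∘ blockdiag ∘ (·, 1) : U(J₁)(𝔸_{F,f}) →* U(H)(𝔸_{F,f})`, `u ↦ B_f (u ⊕ 1) B_f⁻¹`, is the literal composite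
`(finAdelicCongr F E c B ha hB).toMonoidHom.comp ((finAdelicBlockDiag F E c N₁ N₂ J₁ J₂).comp (MonoidHom.inl _ _))`
(★ `UnitaryGroupLevelTransport`, ★ `UnitaryGroupDirectSumCarriersFinite`; at `(N₁, N₂) = (2, 1)` it is the definiens of
★ `UnitaryCanonicalModel.φGS` of `ShimuraVarieties/UnitaryShimuraCurveRecord`, the sub-datum `U(V⋆) ↪ U(V)` of [Liu2021] Thm. 4.15).

CONTENTS.
* §1 (generic topological groups) `OpenCompactSubgroup.restrict φ hφ K₁ K = K₁ ⊓ φ⁻¹(K)` — an open compact subgroup of the source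
  below `K₁` mapping into `K` (`restrict_le`, `map_restrict_le`, `le_restrict_iff`, monotonicity); the level `K⋆ := restrict φGS K₁ K₀`
  of the source tower.
* §2 the rational-points homomorphism `embRational : U(J₁)(F) →* U(H)(F)`, `γ ↦ B·(γ ⊕ 1)·B⁻¹` (★ `rationalBlockDiag`,
  ★ `conj_mem_rational_iff`), injective, and **`φ (γ_f) = (embRational γ)_f`** along the diagonal embeddings `rationalToFinAdelic`
  (★ `finAdelicBlockDiag_rationalToFinAdelic` + ★ `finAdelicCongr_rationalToFinAdelic`).
* §3 arithmetic levels: for ANY `φ` agreeing with `embRational` on rational points and levels `K⋆.map φ ≤ K`,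
  `γ ∈ Γ_{J₁}(K⋆) ⇒ embRational γ ∈ Γ_H(K)`; conjugated levels `K⋆.map (conj g) ↦ K.map (conj (φ g))`.
* §4 TORSION-FREENESS TRANSFER: if `Γ_H(K)` is torsion free then so is `Γ_{J₁}(K⋆)` for every `K⋆` with `K⋆.map φ ≤ K`
  (injectivity of `embRational`), with the conjugated-level and `restrict` corollaries — the neatness hypothesis of the rank-`N₁`
  sub-tower is inherited from the neat rank-`(N₁+N₂)` level.
References for the objects: [PlatonovRapinchuk1994] §4.1 (arithmetic subgroups `G_F ∩ K`, behaviour under morphisms and conjugation)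
and §5.1 (adelic points); the embedding is that of [Liu2021] Thm. 4.15 (proof, l. 2193–2213) / [Kudla1984] §1 (see-saw sub-datum);
levels along a morphism of Shimura data as in [Milne2005ShimuraVarieties] Thm. 13.6 / §5 (`K⋆ ⊆ φ⁻¹(K)`).

Cell `hodgecm-mathlib`, GS-PROGRAMME memo §9 A.11 (G5) (A-plan2 g5): pre-pays GS-3's neatness hypothesis on the source tower,
GS-4/GS-8's level choice, GS-7's piece compatibility.  HC_CM is proved only modulo the 7 printed citations until rung 0 closes.
-/

set_option autoImplicit false

noncomputable section

open scoped Matrix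
open NumberField IsDedekindDomain

namespace Literature.NumberTheory.Automorphic

/-! ## §1. Restricting an open compact level along a continuous homomorphism -/

namespace Liu2021.AppendixC.C5

variable {G G' : Type} [Group G] [TopologicalSpace G] [Group G'] [TopologicalSpace G'] [ContinuousMul G']

/-- **The restricted level `K₁ ⊓ φ⁻¹(K)`** of an open compact subgroup `K₁` of the source along a continuous homomorphism
`φ : G →* G'` and an open compact subgroup `K` of the target: open (both pieces are open) and compact (an open subgroup of a
topological group is closed, so `φ⁻¹(K)` is closed in `G` and `K₁ ∩ φ⁻¹(K)` is a closed subset of the compact `K₁`).  This is the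
level of the source Shimura datum lying over `K` («`K⋆ ⊆ φ⁻¹(K)`» for a morphism of Shimura data).
[cite: Milne2005ShimuraVarieties, Thm. 13.6 p. 118 and §5 (levels along a morphism)] [cite: PlatonovRapinchuk1994, §4.1] -/
def OpenCompactSubgroup.restrict (φ : G →* G') (hφ : Continuous φ) (K₁ : OpenCompactSubgroup G)
    (K : OpenCompactSubgroup G') : OpenCompactSubgroup G :=
  ⟨K₁.1 ⊓ K.1.comap φ, by
    have hcoe : ((K₁.1 ⊓ K.1.comap φ : Subgroup G) : Set G) = (K₁.1 : Set G) ∩ φ ⁻¹' (K.1 : Set G') := by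
      rw [Subgroup.coe_inf, Subgroup.coe_comap]
    refine ⟨?_, ?_⟩
    · rw [hcoe]
      exact K₁.2.1.inter (K.2.1.preimage hφ)
    · rw [hcoe]
      exact K₁.2.2.inter_right ((K.1.isClosed_of_isOpen K.2.1).preimage hφ)⟩

/-- The underlying subgroup of the restricted level is `K₁ ⊓ φ⁻¹(K)`. [cite: PlatonovRapinchuk1994, §4.1] -/
@[simp] theorem OpenCompactSubgroup.restrict_val (φ : G →* G') (hφ : Continuous φ) (K₁ : OpenCompactSubgroup G)
    (K : OpenCompactSubgroup G') : (OpenCompactSubgroup.restrict φ hφ K₁ K).1 = K₁.1 ⊓ K.1.comap φ :=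
  rfl

/-- Membership in the restricted level: `k ∈ K₁` and `φ k ∈ K`. [cite: PlatonovRapinchuk1994, §4.1] -/
theorem OpenCompactSubgroup.mem_restrict_iff (φ : G →* G') (hφ : Continuous φ) (K₁ : OpenCompactSubgroup G)
    (K : OpenCompactSubgroup G') (k : G) :
    k ∈ (OpenCompactSubgroup.restrict φ hφ K₁ K).1 ↔ k ∈ K₁.1 ∧ φ k ∈ K.1 :=
  Iff.rfl

/-- **The restricted level is small**: `restrict φ K₁ K ≤ K₁` (so `⟨restrict φ hφ K₁ K, restrict_le …⟩ : C5.SmallLevel K₁`).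
[cite: Liu2021, Prop. C.5 l. 4627–4628] -/
theorem OpenCompactSubgroup.restrict_le (φ : G →* G') (hφ : Continuous φ) (K₁ : OpenCompactSubgroup G)
    (K : OpenCompactSubgroup G') : OpenCompactSubgroup.restrict φ hφ K₁ K ≤ K₁ :=
  fun _ hk => hk.1

/-- **The restricted level maps into `K`**: `φ (restrict φ K₁ K) ≤ K`. [cite: Milne2005ShimuraVarieties, Thm. 13.6 p. 118 and §5] -/
theorem OpenCompactSubgroup.map_restrict_le (φ : G →* G') (hφ : Continuous φ) (K₁ : OpenCompactSubgroup G)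
    (K : OpenCompactSubgroup G') : (OpenCompactSubgroup.restrict φ hφ K₁ K).1.map φ ≤ K.1 :=
  Subgroup.map_le_iff_le_comap.2 fun _ hk => hk.2

/-- Universal property: a subgroup lies in the restricted level iff it lies in `K₁` and maps into `K`.
[cite: PlatonovRapinchuk1994, §4.1] -/
theorem OpenCompactSubgroup.le_restrict_iff (φ : G →* G') (hφ : Continuous φ) (K₁ : OpenCompactSubgroup G)
    (K : OpenCompactSubgroup G') (K' : Subgroup G) :
    K' ≤ (OpenCompactSubgroup.restrict φ hφ K₁ K).1 ↔ K' ≤ K₁.1 ∧ K'.map φ ≤ K.1 := by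
  rw [OpenCompactSubgroup.restrict_val, le_inf_iff, Subgroup.map_le_iff_le_comap]

/-- The restricted level is monotone in the target level. [cite: Liu2021, Prop. C.5 l. 4627–4628] -/
theorem OpenCompactSubgroup.restrict_mono_right (φ : G →* G') (hφ : Continuous φ) (K₁ : OpenCompactSubgroup G)
    {K K' : OpenCompactSubgroup G'} (h : K ≤ K') :
    OpenCompactSubgroup.restrict φ hφ K₁ K ≤ OpenCompactSubgroup.restrict φ hφ K₁ K' :=
  fun _ hk => ⟨hk.1, h hk.2⟩

/-- The restricted level is monotone in the source threshold. [cite: Liu2021, Prop. C.5 l. 4627–4628] -/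
theorem OpenCompactSubgroup.restrict_mono_left (φ : G →* G') (hφ : Continuous φ) {K₁ K₁' : OpenCompactSubgroup G}
    (h : K₁ ≤ K₁') (K : OpenCompactSubgroup G') :
    OpenCompactSubgroup.restrict φ hφ K₁ K ≤ OpenCompactSubgroup.restrict φ hφ K₁' K :=
  fun _ hk => ⟨h hk.1, hk.2⟩

/-- If `K₁` already maps into `K`, restriction does nothing: `restrict φ K₁ K = K₁`. [cite: PlatonovRapinchuk1994, §4.1] -/
theorem OpenCompactSubgroup.restrict_eq_self_of_map_le (φ : G →* G') (hφ : Continuous φ) (K₁ : OpenCompactSubgroup G)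
    (K : OpenCompactSubgroup G') (h : K₁.1.map φ ≤ K.1) : OpenCompactSubgroup.restrict φ hφ K₁ K = K₁ :=
  Subtype.ext (le_antisymm (fun _ hk => hk.1) fun _ hk => ⟨hk, Subgroup.map_le_iff_le_comap.1 h hk⟩)

end Liu2021.AppendixC.C5

/-! ## §2. The rational-points homomorphism `γ ↦ B·(γ ⊕ 1)·B⁻¹` and its compatibility with `φ` -/

namespace UnitaryGroup

open Literature.NumberTheory.Automorphic.Liu2021.AppendixC (C5.OpenCompactSubgroup)

variable (F E : Type) [Field F] [NumberField F] [Field E] [NumberField E] [Algebra F E]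
variable (c : E ≃ₐ[F] E) (N₁ N₂ : ℕ) (J₁ : Matrix (Fin N₁) (Fin N₁) E) (J₂ : Matrix (Fin N₂) (Fin N₂) E)
variable (H : Matrix (Fin (N₁ + N₂)) (Fin (N₁ + N₂)) E) (B : GL (Fin (N₁ + N₂)) E) {a : E} (ha : a ≠ 0)
variable (hB : formCongr (c : E →+* E) B (a • H) = finSum N₁ N₂ J₁ J₂)

omit [NumberField F] [NumberField E] in
/-- **`U(J₁)(F) →* U(H)(F)`, `γ ↦ B·(γ ⊕ 1)·B⁻¹`** — the rational points of the sub-datum `U(V⋆) ↪ U(V)`, `V = V⋆ ⊕ V⋆^⊥`, through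
the frame `B` with `ᵗ(cB)·(a·H)·B = J₁ ⊕ᶠ J₂` (★ `rationalBlockDiag (γ, 1)` conjugated into `U(H)(F)` by ★ `conj_mem_rational_iff`).
[cite: Liu2021, Thm. 4.15 proof (FJcycle.tex l. 2193–2203)] [cite: PlatonovRapinchuk1994, §2.3] -/
def embRational : rational F E c N₁ J₁ →* rational F E c (N₁ + N₂) H :=
  MonoidHom.codRestrict
    ((MulAut.conj B).toMonoidHom.comp ((rational F E c (N₁ + N₂) (finSum N₁ N₂ J₁ J₂)).subtype.comp
      ((rationalBlockDiag F E c N₁ N₂ J₁ J₂).comp (MonoidHom.inl _ _))))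
    (rational F E c (N₁ + N₂) H)
    fun γ => (conj_mem_rational_iff F E c B ha hB _).1 (rationalBlockDiag F E c N₁ N₂ J₁ J₂ (γ, 1)).2

omit [NumberField F] [NumberField E] in
/-- `embRational γ` in `GL_{N₁+N₂}(E)`: `B · (γ ⊕ᶠ 1) · B⁻¹`. [cite: Liu2021, Thm. 4.15 proof (FJcycle.tex l. 2193–2203)] -/
theorem coe_embRational (γ : rational F E c N₁ J₁) :
    ((embRational F E c N₁ N₂ J₁ J₂ H B ha hB γ : rational F E c (N₁ + N₂) H) : GL (Fin (N₁ + N₂)) E) =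
      B * (rationalBlockDiag F E c N₁ N₂ J₁ J₂ (γ, 1) : rational F E c (N₁ + N₂) (finSum N₁ N₂ J₁ J₂)) * B⁻¹ :=
  rfl

omit [NumberField F] [NumberField E] in
/-- `embRational γ` as a matrix: `B · reindex (fromBlocks γ 0 0 1) · B⁻¹`. [cite: Liu2021, Thm. 4.15 proof (FJcycle.tex l. 2193–2203)] -/
theorem coe_embRational_eq_reindexGL (γ : rational F E c N₁ J₁) :
    ((embRational F E c N₁ N₂ J₁ J₂ H B ha hB γ : rational F E c (N₁ + N₂) H) : GL (Fin (N₁ + N₂)) E) =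
      B * reindexGL finSumFinEquiv (blockDiagGL ((γ : GL (Fin N₁) E), (1 : GL (Fin N₂) E))) * B⁻¹ :=
  rfl

omit [NumberField F] [NumberField E] in
/-- **`embRational` is injective** (conjugation by `B` and `γ ↦ γ ⊕ 1` are). [cite: PlatonovRapinchuk1994, §2.3] -/
theorem embRational_injective : Function.Injective (embRational F E c N₁ N₂ J₁ J₂ H B ha hB) := by
  intro γ γ' h
  have h1 := congrArg (fun g : rational F E c (N₁ + N₂) H => (g : GL (Fin (N₁ + N₂)) E)) h
  simp only [coe_embRational, mul_left_inj, mul_right_inj] at h1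
  have h2 : rationalBlockDiag F E c N₁ N₂ J₁ J₂ (γ, 1) = rationalBlockDiag F E c N₁ N₂ J₁ J₂ (γ', 1) := Subtype.ext h1
  exact (Prod.mk.inj (blockDiagFin_injective _ _ _ h2)).1

omit [NumberField F] in
/-- **Rational points go to rational points along `φ = R_B ∘ blockdiag ∘ (·, 1)`**: `B_f ((γ)_f ⊕ 1) B_f⁻¹ = (B(γ ⊕ 1)B⁻¹)_f`, i.e.
`φ (γ_f) = (embRational γ)_f` for the diagonal embeddings `rationalToFinAdelic` (★ `finAdelicBlockDiag_rationalToFinAdelic`,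
★ `finAdelicCongr_rationalToFinAdelic`). [cite: PlatonovRapinchuk1994, §5.1] [cite: Liu2021, Thm. 4.15 proof (FJcycle.tex l. 2193–2203)] -/
theorem finAdelicCongr_finAdelicBlockDiag_rationalToFinAdelic (γ : rational F E c N₁ J₁) :
    finAdelicCongr F E c B ha hB
        (finAdelicBlockDiag F E c N₁ N₂ J₁ J₂ (rationalToFinAdelic F E c N₁ J₁ γ, 1)) =
      rationalToFinAdelic F E c (N₁ + N₂) H (embRational F E c N₁ N₂ J₁ J₂ H B ha hB γ) := by
  have h1 : (rationalToFinAdelic F E c N₁ J₁ γ, (1 : finAdelic F E c N₂ J₂)) =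
      (rationalToFinAdelic F E c N₁ J₁ γ, rationalToFinAdelic F E c N₂ J₂ 1) := by
    rw [map_one]
  rw [h1, finAdelicBlockDiag_rationalToFinAdelic, finAdelicCongr_rationalToFinAdelic]
  rfl

omit [NumberField F] in
/-- The same for the literal composite homomorphism `φ = (finAdelicCongr B).toMonoidHom ∘ finAdelicBlockDiag ∘ inl` (the definiens
of ★ `UnitaryCanonicalModel.φGS` at `(N₁, N₂) = (2, 1)`): `φ (γ_f) = (embRational γ)_f`. [cite: PlatonovRapinchuk1994, §5.1] -/
theorem frameEmb_rationalToFinAdelic (γ : rational F E c N₁ J₁) :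
    ((finAdelicCongr F E c B ha hB).toMonoidHom.comp
        ((finAdelicBlockDiag F E c N₁ N₂ J₁ J₂).comp (MonoidHom.inl _ _))) (rationalToFinAdelic F E c N₁ J₁ γ) =
      rationalToFinAdelic F E c (N₁ + N₂) H (embRational F E c N₁ N₂ J₁ J₂ H B ha hB γ) :=
  finAdelicCongr_finAdelicBlockDiag_rationalToFinAdelic F E c N₁ N₂ J₁ J₂ H B ha hB γ

omit [NumberField F] in
/-- Homomorphism form: `φ ∘ (·)_f = (·)_f ∘ embRational` as homomorphisms `U(J₁)(F) →* U(H)(𝔸_{F,f})`.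
[cite: PlatonovRapinchuk1994, §5.1] -/
theorem frameEmb_comp_rationalToFinAdelic :
    ((finAdelicCongr F E c B ha hB).toMonoidHom.comp
        ((finAdelicBlockDiag F E c N₁ N₂ J₁ J₂).comp (MonoidHom.inl _ _))).comp (rationalToFinAdelic F E c N₁ J₁) =
      (rationalToFinAdelic F E c (N₁ + N₂) H).comp (embRational F E c N₁ N₂ J₁ J₂ H B ha hB) :=
  MonoidHom.ext fun γ => finAdelicCongr_finAdelicBlockDiag_rationalToFinAdelic F E c N₁ N₂ J₁ J₂ H B ha hB γ

omit [NumberField F] in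
/-- The literal composite is continuous (★ `finAdelicCongr` is a homeomorphism, ★ `finAdelicBlockDiag` is continuous).
[cite: PlatonovRapinchuk1994, §5.1] -/
theorem continuous_frameEmb :
    Continuous ((finAdelicCongr F E c B ha hB).toMonoidHom.comp
      ((finAdelicBlockDiag F E c N₁ N₂ J₁ J₂).comp (MonoidHom.inl _ _))) :=
  (finAdelicCongr F E c B ha hB).continuous.comp
    ((continuous_finAdelicBlockDiag F E c N₁ N₂ J₁ J₂).comp (continuous_id.prodMk continuous_const))

/-! ## §3. Arithmetic levels along `φ` -/

variable {F E c N₁ N₂ J₁ J₂ H B ha hB}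

omit [NumberField F] in
/-- **Arithmetic levels along the embedding**: for any `φ : U(J₁)(𝔸_{F,f}) →* U(H)(𝔸_{F,f})` agreeing with `embRational` on rational
points and levels with `φ(K⋆) ⊆ K`: `γ ∈ Γ_{J₁}(K⋆) ⇒ B(γ ⊕ 1)B⁻¹ ∈ Γ_H(K)`. [cite: PlatonovRapinchuk1994, §4.1] -/
theorem coe_embRational_mem_arithmeticLevel {φ : finAdelic F E c N₁ J₁ →* finAdelic F E c (N₁ + N₂) H}
    (hφ : ∀ γ : rational F E c N₁ J₁,
      φ (rationalToFinAdelic F E c N₁ J₁ γ) = rationalToFinAdelic F E c (N₁ + N₂) H (embRational F E c N₁ N₂ J₁ J₂ H B ha hB γ))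
    {Ks : Subgroup (finAdelic F E c N₁ J₁)} {K : Subgroup (finAdelic F E c (N₁ + N₂) H)} (hle : Ks.map φ ≤ K)
    (γ : rational F E c N₁ J₁) (hγ : (γ : GL (Fin N₁) E) ∈ arithmeticLevel F E c N₁ J₁ Ks) :
    ((embRational F E c N₁ N₂ J₁ J₂ H B ha hB γ : rational F E c (N₁ + N₂) H) : GL (Fin (N₁ + N₂)) E) ∈
      arithmeticLevel F E c (N₁ + N₂) H K := by
  obtain ⟨hγr, hγK⟩ := mem_arithmeticLevel_iff.1 hγ
  have hγK' : rationalToFinAdelic F E c N₁ J₁ γ ∈ Ks := by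
    have : (⟨(γ : GL (Fin N₁) E), hγr⟩ : rational F E c N₁ J₁) = γ := Subtype.ext rfl
    rwa [this] at hγK
  refine mem_arithmeticLevel_iff.2 ⟨(embRational F E c N₁ N₂ J₁ J₂ H B ha hB γ).2, ?_⟩
  have hmem : φ (rationalToFinAdelic F E c N₁ J₁ γ) ∈ K := hle (Subgroup.mem_map_of_mem φ hγK')
  rw [hφ] at hmem
  exact hmem

omit [NumberField F] in
/-- The same with a `GL_{N₁}(E)`-element and its rationality witness (the shape `∀ γ ∈ arithmeticLevel …` quantifies over).
[cite: PlatonovRapinchuk1994, §4.1] -/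
theorem conj_blockDiag_mem_arithmeticLevel {φ : finAdelic F E c N₁ J₁ →* finAdelic F E c (N₁ + N₂) H}
    (hφ : ∀ γ : rational F E c N₁ J₁,
      φ (rationalToFinAdelic F E c N₁ J₁ γ) = rationalToFinAdelic F E c (N₁ + N₂) H (embRational F E c N₁ N₂ J₁ J₂ H B ha hB γ))
    {Ks : Subgroup (finAdelic F E c N₁ J₁)} {K : Subgroup (finAdelic F E c (N₁ + N₂) H)} (hle : Ks.map φ ≤ K)
    {γ : GL (Fin N₁) E} (hγ : γ ∈ arithmeticLevel F E c N₁ J₁ Ks) :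
    B * reindexGL finSumFinEquiv (blockDiagGL (γ, (1 : GL (Fin N₂) E))) * B⁻¹ ∈ arithmeticLevel F E c (N₁ + N₂) H K :=
  coe_embRational_mem_arithmeticLevel hφ hle ⟨γ, arithmeticLevel_le_rational Ks hγ⟩ hγ

omit [NumberField F] in
/-- **Conjugated levels**: `φ (g k g⁻¹) = φ(g) φ(k) φ(g)⁻¹`, so `φ(K⋆) ⊆ K ⇒ φ(g K⋆ g⁻¹) ⊆ φ(g) K φ(g)⁻¹` (the conjugates
`K₀.map (conj g)` appearing in the neatness hypotheses). [cite: PlatonovRapinchuk1994, §4.1] -/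
theorem map_conj_map_le_of_map_le {G G' : Type} [Group G] [Group G'] (φ : G →* G') {Ks : Subgroup G} {K : Subgroup G'}
    (hle : Ks.map φ ≤ K) (g : G) :
    (Ks.map (MulAut.conj g).toMonoidHom).map φ ≤ K.map (MulAut.conj (φ g)).toMonoidHom := by
  rw [Subgroup.map_map]
  have hcomp : φ.comp (MulAut.conj g).toMonoidHom = (MulAut.conj (φ g)).toMonoidHom.comp φ := by
    ext k
    simp only [MonoidHom.coe_comp, MulEquiv.coe_toMonoidHom, Function.comp_apply, MulAut.conj_apply, map_mul, map_inv]
  rw [hcomp, ← Subgroup.map_map]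
  exact Subgroup.map_mono hle

/-! ## §4. Torsion-freeness transfer -/

omit [NumberField F] in
/-- **TORSION-FREENESS IS INHERITED BY THE SUB-TOWER**: if the arithmetic level `Γ_H(K)` is torsion free, then so is
`Γ_{J₁}(K⋆)` for every level `K⋆` with `φ(K⋆) ⊆ K` and any `φ` agreeing with `embRational` on rational points
(`embRational` is an injective homomorphism, so it preserves and reflects «of finite order» and `= 1`).
[cite: PlatonovRapinchuk1994, §4.1] [cite: Milne2005ShimuraVarieties, Thm. 13.6 p. 118 and §5] -/
theorem torsionFree_arithmeticLevel_of_map_le {φ : finAdelic F E c N₁ J₁ →* finAdelic F E c (N₁ + N₂) H}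
    (hφ : ∀ γ : rational F E c N₁ J₁,
      φ (rationalToFinAdelic F E c N₁ J₁ γ) = rationalToFinAdelic F E c (N₁ + N₂) H (embRational F E c N₁ N₂ J₁ J₂ H B ha hB γ))
    {Ks : Subgroup (finAdelic F E c N₁ J₁)} {K : Subgroup (finAdelic F E c (N₁ + N₂) H)} (hle : Ks.map φ ≤ K)
    (hK : ∀ g ∈ arithmeticLevel F E c (N₁ + N₂) H K, IsOfFinOrder g → g = 1) :
    ∀ γ ∈ arithmeticLevel F E c N₁ J₁ Ks, IsOfFinOrder γ → γ = 1 := by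
  intro γ hγ hfin
  set γr : rational F E c N₁ J₁ := ⟨γ, arithmeticLevel_le_rational Ks hγ⟩ with hγr
  have hmem := coe_embRational_mem_arithmeticLevel hφ hle γr hγ
  have hfin_r : IsOfFinOrder γr := Submonoid.isOfFinOrder_coe.1 (by exact hfin)
  have hfin_img : IsOfFinOrder
      ((embRational F E c N₁ N₂ J₁ J₂ H B ha hB γr : rational F E c (N₁ + N₂) H) : GL (Fin (N₁ + N₂)) E) :=
    Submonoid.isOfFinOrder_coe.2 ((embRational F E c N₁ N₂ J₁ J₂ H B ha hB).isOfFinOrder hfin_r)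
  have h1 : embRational F E c N₁ N₂ J₁ J₂ H B ha hB γr = 1 :=
    Subtype.ext (hK _ hmem hfin_img)
  have h2 : γr = 1 := embRational_injective F E c N₁ N₂ J₁ J₂ H B ha hB (by rw [h1, map_one])
  exact congrArg (fun g : rational F E c N₁ J₁ => (g : GL (Fin N₁) E)) h2

omit [NumberField F] in
/-- **Torsion-freeness transfer for all conjugated levels** (the shape of the neatness hypotheses
`∀ g, ∀ γ ∈ Γ(g K g⁻¹), IsOfFinOrder γ → γ = 1`): if every conjugate `Γ_H(g K g⁻¹)`, `g ∈ U(H)(𝔸_{F,f})`, is torsion free and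
`φ(K⋆) ⊆ K`, then every conjugate `Γ_{J₁}(g⋆ K⋆ g⋆⁻¹)`, `g⋆ ∈ U(J₁)(𝔸_{F,f})`, is torsion free.
[cite: PlatonovRapinchuk1994, §4.1] [cite: Milne2005ShimuraVarieties, Thm. 13.6 p. 118 and §5] -/
theorem torsionFree_arithmeticLevel_conj_of_map_le {φ : finAdelic F E c N₁ J₁ →* finAdelic F E c (N₁ + N₂) H}
    (hφ : ∀ γ : rational F E c N₁ J₁,
      φ (rationalToFinAdelic F E c N₁ J₁ γ) = rationalToFinAdelic F E c (N₁ + N₂) H (embRational F E c N₁ N₂ J₁ J₂ H B ha hB γ))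
    {Ks : Subgroup (finAdelic F E c N₁ J₁)} {K : Subgroup (finAdelic F E c (N₁ + N₂) H)} (hle : Ks.map φ ≤ K)
    (hK : ∀ g : finAdelic F E c (N₁ + N₂) H,
      ∀ δ ∈ arithmeticLevel F E c (N₁ + N₂) H (K.map (MulAut.conj g).toMonoidHom), IsOfFinOrder δ → δ = 1)
    (g : finAdelic F E c N₁ J₁) :
    ∀ γ ∈ arithmeticLevel F E c N₁ J₁ (Ks.map (MulAut.conj g).toMonoidHom), IsOfFinOrder γ → γ = 1 :=
  torsionFree_arithmeticLevel_of_map_le hφ (map_conj_map_le_of_map_le φ hle g) (hK (φ g))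

variable (F E c N₁ N₂ J₁ J₂ H B ha hB)

omit [NumberField F] in
/-- **The literal frame embedding, restricted levels**: for `φ = (finAdelicCongr B).toMonoidHom ∘ finAdelicBlockDiag ∘ inl` and the
restricted level `K⋆ = restrict φ K₁ K` (§1), torsion-freeness of `Γ_H(K)` gives torsion-freeness of `Γ_{J₁}(K⋆)`.
[cite: PlatonovRapinchuk1994, §4.1] [cite: Milne2005ShimuraVarieties, Thm. 13.6 p. 118 and §5] -/
theorem torsionFree_arithmeticLevel_restrict (K₁ : C5.OpenCompactSubgroup (finAdelic F E c N₁ J₁))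
    (K : C5.OpenCompactSubgroup (finAdelic F E c (N₁ + N₂) H))
    (hK : ∀ g ∈ arithmeticLevel F E c (N₁ + N₂) H K.1, IsOfFinOrder g → g = 1) :
    ∀ γ ∈ arithmeticLevel F E c N₁ J₁
        (C5.OpenCompactSubgroup.restrict
          ((finAdelicCongr F E c B ha hB).toMonoidHom.comp ((finAdelicBlockDiag F E c N₁ N₂ J₁ J₂).comp (MonoidHom.inl _ _)))
          (continuous_frameEmb F E c N₁ N₂ J₁ J₂ H B ha hB) K₁ K).1,
      IsOfFinOrder γ → γ = 1 :=
  torsionFree_arithmeticLevel_of_map_le (frameEmb_rationalToFinAdelic F E c N₁ N₂ J₁ J₂ H B ha hB)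
    (C5.OpenCompactSubgroup.map_restrict_le _ _ K₁ K) hK

omit [NumberField F] in
/-- **The literal frame embedding, conjugated levels**: if `φ(K⋆) ⊆ K` and all conjugates `Γ_H(g K g⁻¹)` are torsion free, then all
conjugates `Γ_{J₁}(g⋆ K⋆ g⋆⁻¹)` are torsion free — the neatness hypothesis of the source tower in the shape
`∀ g⋆, ∀ γ ∈ arithmeticLevel … J₁ (K⋆.map (conj g⋆)), IsOfFinOrder γ → γ = 1`.
[cite: PlatonovRapinchuk1994, §4.1] [cite: Milne2005ShimuraVarieties, Thm. 13.6 p. 118 and §5] -/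
theorem torsionFree_arithmeticLevel_conj_frameEmb {Ks : Subgroup (finAdelic F E c N₁ J₁)}
    {K : Subgroup (finAdelic F E c (N₁ + N₂) H)}
    (hle : Ks.map ((finAdelicCongr F E c B ha hB).toMonoidHom.comp
      ((finAdelicBlockDiag F E c N₁ N₂ J₁ J₂).comp (MonoidHom.inl _ _))) ≤ K)
    (hK : ∀ g : finAdelic F E c (N₁ + N₂) H,
      ∀ δ ∈ arithmeticLevel F E c (N₁ + N₂) H (K.map (MulAut.conj g).toMonoidHom), IsOfFinOrder δ → δ = 1)
    (g : finAdelic F E c N₁ J₁) :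
    ∀ γ ∈ arithmeticLevel F E c N₁ J₁ (Ks.map (MulAut.conj g).toMonoidHom), IsOfFinOrder γ → γ = 1 :=
  torsionFree_arithmeticLevel_conj_of_map_le (frameEmb_rationalToFinAdelic F E c N₁ N₂ J₁ J₂ H B ha hB) hle hK g

omit [NumberField F] in
/-- Arithmetic levels along the literal frame embedding: `γ ∈ Γ_{J₁}(K⋆)`, `φ(K⋆) ⊆ K` ⇒ `B(γ ⊕ 1)B⁻¹ ∈ Γ_H(K)`.
[cite: PlatonovRapinchuk1994, §4.1] -/
theorem conj_blockDiag_mem_arithmeticLevel_frameEmb {Ks : Subgroup (finAdelic F E c N₁ J₁)}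
    {K : Subgroup (finAdelic F E c (N₁ + N₂) H)}
    (hle : Ks.map ((finAdelicCongr F E c B ha hB).toMonoidHom.comp
      ((finAdelicBlockDiag F E c N₁ N₂ J₁ J₂).comp (MonoidHom.inl _ _))) ≤ K)
    {γ : GL (Fin N₁) E} (hγ : γ ∈ arithmeticLevel F E c N₁ J₁ Ks) :
    B * reindexGL finSumFinEquiv (blockDiagGL (γ, (1 : GL (Fin N₂) E))) * B⁻¹ ∈ arithmeticLevel F E c (N₁ + N₂) H K :=
  conj_blockDiag_mem_arithmeticLevel (frameEmb_rationalToFinAdelic F E c N₁ N₂ J₁ J₂ H B ha hB) hle hγ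

end UnitaryGroup

end Literature.NumberTheory.Automorphic

end
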